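import Summits.ValiantsHypothesis.ValiantsHypothesis.Theorems.MonotoneRestorationOrbitRestorationQPDepthThreeRungDefs
import Literature.Barriers.ValiantsHypothesis.DepthThreeChasmTight
import Literature.Computability.AlgebraicComplexity.ArithCircuitProjections
import Literature.Computability.AlgebraicComplexity.ValiantCompleteness
import Literature.Computability.AlgebraicComplexity.ValiantConjectureEquivProofs
import Literature.Computability.AlgebraicComplexity.IMMInVPProofs
import Summits.ValiantsHypothesis.ValiantsHypothesis.Theorems.MonotoneRestorationOrbitCompressionQPOrbitToNarrowExpressionFalse
import Summits.ValiantsHypothesis.ValiantsHypothesis.Theorems.MonotoneRestorationOrbitRestorationQPWildResidueSharp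
import HarnessLib

/-!
# Route MonotoneRestoration — crux `OrbitRestorationQP` (stmt-ValiantsHypothesis-18293), line `depth-three-rung`:
# THE PERMANENT — AND EVERY `IMM`-HARD FAMILY — IS OUTSIDE THE RUNG'S HYPOTHESIS CLASS, UNCONDITIONALLY

The open stub `stub_sigmaPiSigmaValue` (`A_∞`) of `Cruxes/OrbitRestorationQP/Lines/depth_three_rung.lean` quantifies over
matrix-symmetric families in `PDClass (fun _ => 1) n c` (polynomial-size `ΣΠΣ` circuits with the class's degree /
complexity envelope, `Theorems/…DepthThreeRungDefs.lean`).  `Theorems/…RungCalibration.lean` records the rung's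
"lower-bound content": `A_∞ ⇒` the permanent lies in `PDClass 1 · c` for no `c`
(`RungCalibration.perPoly_not_pdClassOne_of_sigmaPiSigmaValue`), adding that unconditionally this is "known only via
Limaye–Srinivasan–Tavenas 2021 and `VNP`-completeness; it is not in the tree".  Both ingredients ARE in the tree and
PROVED (`Literature.Computability.Complexity.lst_constantDepth_imm_lower_bound_holds` — LST, J. ACM 72 (2025) Cor. 4 —
and `Literature.Computability.AlgebraicComplexity.isVNPComplete_perPoly_holds` — Valiant 1979 / BCS Thm 21.x), so this
file DISCHARGES the consequence without `A_∞` and, more usefully for the line, fences the refutation side: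

* `exists_sps_of_isProjection` — a projection (variables ↦ variables or constants) of a polynomial with a
  product-depth-`≤ Δ` circuit of `E` wires has a product-depth-`≤ Δ` circuit with `≤ E` wires AND `≤ E` gates
  (`ArithCircuit.substVC` + empty-gate pruning `ArithCircuit.exists_size_le_edgeSize`);
* `isProjection_rename` — projections are stable under renaming the target's variables;
* `not_pdClassOne_of_immProjection` — **TRANSFER**: no family `F : (m : ℕ) → ℂ[x_ij : i, j < m]` into which the
  iterated-matrix-multiplication polynomials `IMM_{n,d}` project with polynomial blow-up (`IMM_{n,d}` a projection of
  `F m` for some `m ≤ (n + d + 2)^a`) lies in `PDClass 1 · c` for any `c`: LST Cor. 4 at `Δ = 1` and the arithmetic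
  `chasm_arith` of `Literature/Barriers/ValiantsHypothesis/DepthThreeChasmTight.lean`;
* `perPoly_immProjection` — the permanent is such an `F` (the universal `IMM` family `N ↦ IMM_{(unpair N).1,(unpair N).2}`
  is a `VP`, hence `VNP`, family; Valiant completeness gives the p-projection);
* `perPoly_not_pdClassOne` — **UNCONDITIONAL**: `¬ ∃ c, ∀ n, PDClass (fun _ => 1) n c (per_n)`; the hypothesis `hA` of
  `RungCalibration.perPoly_not_pdClassOne_of_sigmaPiSigmaValue` is idle;
* `killWitness_not_immHard` — consequently a kill witness for `A_∞` in the sense of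
  `RungCalibration.sigmaPiSigmaValue_false_of_separating` (a `PDClass 1` family separating graphs of polylogarithmic
  counting width) can never be `IMM`-hard: no `VNP`-complete, `VP`-complete or `VBP`-complete family, and no family to
  which any of them reduces by p-projection, is available as a counterexample to the rung.  A depth-three "arithmetic
  CFI family" must come from the thin class `ΣΠΣ(poly)` itself.

* `counterexample_window` (appended) — **WHERE A COUNTEREXAMPLE TO `A_∞` CAN LIVE**, kernel-assembled from landed
  strata: a matrix-symmetric family in `PDClass 1 · c` that is NOT quasi-polynomially orbit-restorable (i) has total
  degree above every polylogarithm at some level (floor `OrbitToNarrowExpression.qpOrbit_of_polylogDegree_of_diagInvariant`),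
  (ii) is not `IMM`-hard (`killWitness_not_immHard`), and (iii) for every `c` has a level `n` at which `f n` is not
  `c`-restorable, is not killed by some double-difference derivation (`f n ∉ ℂ[r, c]`,
  `RowColumnDerivativeConverse`) and is not within-row symmetric (`RowColumnWreath`).

* `not_pdClassOne_of_perProjection` (appended) — the same transfer along the PERMANENT: no family onto which the
  permanents project with polynomial blow-up (`VNP`-hard families) is in `PDClass 1 · c`.

* `not_isVNPComplete_of_pdClassOne` (appended) — BY NAME: a family in `PDClass 1 · c` is not `IsVNPComplete`; no
  `VNP`-complete family has polynomial `ΣΠΣ` circuits over `ℂ` (the skeleton's docstring remark, now a kernel theorem).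

Calibration, honestly: this moves neither stub; it corrects the census (the per-instance of the rung's lower-bound
content is a theorem of the tree, not open-problem-grade evidence) and closes the `IMM`-hard half of the refutation
instrument.  VP ≠ VNP is not touched.

## References
* N. Limaye, S. Srinivasan, S. Tavenas, *Superpolynomial lower bounds against low-depth algebraic circuits*,
  J. ACM 72 (2025) Art. 26 (FOCS 2021), Cor. 4. [LimayeSrinivasanTavenas2021]
* L. G. Valiant, *Completeness classes in algebra*, STOC 1979; P. Bürgisser, *Completeness and Reduction in
  Algebraic Complexity Theory*, Springer 2000, Thm 2.10, Def. 2.6. [Valiant1979, Burgisser2000]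
* A. Dawar, G. Wilsenach, *Symmetric arithmetic circuits*, ToC 21 (2025), Thm 7.1, §8. [DawarWilsenach2025]
-/

noncomputable section

open scoped Classical

-- `Summit.ValiantsHypothesis.ValiantsHypothesis.…` is the tree's single-conjunct layout (Sub = Summit).
set_option linter.dupNamespace false

namespace Summit.ValiantsHypothesis.ValiantsHypothesis.Theorems.OrbitRestorationQPDepthThreeRung

namespace PermanentOutsideRung

open Literature.Computability.AlgebraicComplexity Literature.Computability.Complexity
open Literature.Barriers.ValiantsHypothesis MvPolynomial

/-! ### Projections of `ΣΠΣ` circuits -/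

/-- **Projections keep product depth and wires, and can be pruned to few gates.**  If `g` is a projection of `f`
(each variable of `f` replaced by a variable of `g` or a constant) and `P` computes `f`, then some circuit computes
`g` with product-depth `≤` that of `P`, at most as many wires, and at most as many GATES as `P` has wires
(`ArithCircuit.substVC`, then empty-gate pruning). [cite: Burgisser2000, Def. 2.6 and Rem. 2.2] -/
theorem exists_sps_of_isProjection {σ τ : Type} {g : MvPolynomial τ ℂ} {f : MvPolynomial σ ℂ}
    (hproj : IsProjection g f) {P : ArithCircuit ℂ σ} (hP : P.Computes f) :
    ∃ Q : ArithCircuit ℂ τ, Q.Computes g ∧ Q.productDepth ≤ P.productDepth ∧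
      Q.edgeSize ≤ P.edgeSize ∧ Q.size ≤ P.edgeSize := by
  obtain ⟨a, ha, hg⟩ := hproj
  have hs : ∃ s : σ → τ ⊕ ℂ, ArithCircuit.substVCFun s = a := by
    refine ⟨fun i => if h : ∃ j, a i = X j then Sum.inl h.choose
      else Sum.inr ((ha i).resolve_left h).choose, funext fun i => ?_⟩
    by_cases h : ∃ j, a i = X j
    · simp only [ArithCircuit.substVCFun, dif_pos h, Sum.elim_inl]
      exact h.choose_spec.symm
    · simp only [ArithCircuit.substVCFun, dif_neg h, Sum.elim_inr]
      exact ((ha i).resolve_left h).choose_spec.symm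
  obtain ⟨s, hs⟩ := hs
  obtain ⟨Q, hQe, hQpd, hQE, hQs⟩ := (P.substVC s).exists_size_le_edgeSize
  rw [ArithCircuit.productDepth_substVC] at hQpd
  rw [ArithCircuit.edgeSize_substVC] at hQE
  refine ⟨Q, ?_, hQpd, hQE, hQs.trans hQE⟩
  rw [ArithCircuit.Computes, hQe, ArithCircuit.eval_substVC, hs, hg]
  rw [ArithCircuit.Computes] at hP
  rw [hP]

/-- Projections are stable under renaming the variables of the projected polynomial: a renamed variable is a
variable, a renamed constant is a constant. [cite: Burgisser2000, Def. 2.6 and Rem. 2.2] -/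
theorem isProjection_rename {σ τ τ' : Type} {g : MvPolynomial τ ℂ} {f : MvPolynomial σ ℂ}
    (h : IsProjection g f) (φ : τ → τ') : IsProjection (rename φ g) f := by
  obtain ⟨a, ha, hg⟩ := h
  refine ⟨fun i => rename φ (a i), fun i => ?_, ?_⟩
  · rcases ha i with ⟨j, hj⟩ | ⟨c, hc⟩
    · exact Or.inl ⟨φ j, by simp only [hj, rename_X]⟩
    · exact Or.inr ⟨c, by simp only [hc, rename_C]⟩
  · rw [hg, ← comp_aeval]
    rfl

/-! ### Transfer: `IMM`-hard families are outside `PDClass 1` -/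

/-- Little arithmetic: `m ≤ X^a`, `2 ≤ X` ⇒ `m^c + c ≤ X^(a*c + c + 1)`. [folklore] -/
theorem pow_add_le_pow {m X a c : ℕ} (hm : m ≤ X ^ a) (hX : 2 ≤ X) :
    m ^ c + c ≤ X ^ (a * c + c + 1) := by
  have hX1 : 1 ≤ X := le_trans (by norm_num) hX
  have h1 : m ^ c ≤ X ^ (a * c + c) :=
    (Nat.pow_le_pow_left hm c).trans (by rw [← pow_mul]; exact Nat.pow_le_pow_right hX1 (by omega))
  have h2 : c ≤ X ^ (a * c + c) :=
    calc c ≤ 2 ^ c := Nat.lt_two_pow_self.le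
      _ ≤ X ^ c := Nat.pow_le_pow_left hX c
      _ ≤ X ^ (a * c + c) := Nat.pow_le_pow_right hX1 (by omega)
  calc m ^ c + c ≤ X ^ (a * c + c) + X ^ (a * c + c) := Nat.add_le_add h1 h2
    _ = 2 * X ^ (a * c + c) := by ring
    _ ≤ X * X ^ (a * c + c) := Nat.mul_le_mul_right _ hX
    _ = X ^ (a * c + c + 1) := by ring

/-- **TRANSFER.**  If the iterated-matrix-multiplication polynomials `IMM_{n,d}` (tree `immPoly n d ℂ`, degree `d`,
`d n²` variables) are projections of the family `F` with polynomial blow-up — `IMM_{n,d}` a projection of `F m` for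
some `m ≤ (n + d + 2)^a` — then `F` lies in the `ΣΠΣ` slice `PDClass (fun _ => 1) · c` for NO exponent `c`.
Proof: a polynomial-wire `ΣΠΣ` circuit for `F m` projects and prunes to a polynomial-GATE `ΣΠΣ` circuit for
`IMM_{n,d}` (`exists_sps_of_isProjection`), contradicting Limaye–Srinivasan–Tavenas Cor. 4 at product-depth `1`
(`lst_constantDepth_imm_lower_bound_holds`, size `≥ n^{d^δ}` for `d₀ ≤ d ≤ ε log n`) at the parameters supplied
by `chasm_arith`. [cite: LimayeSrinivasanTavenas2021, Cor. 4] -/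
theorem not_pdClassOne_of_immProjection (F : (m : ℕ) → MvPolynomial (Fin m × Fin m) ℂ)
    (hF : ∃ a : ℕ, ∀ n d : ℕ, ∃ m : ℕ, m ≤ (n + d + 2) ^ a ∧ IsProjection (immPoly n d ℂ) (F m)) :
    ¬ ∃ c : ℕ, ∀ m : ℕ, PDClass (fun _ => 1) m c (F m) := by
  rintro ⟨c, hc⟩
  obtain ⟨a, ha⟩ := hF
  obtain ⟨δ, hδ, ε, hε, d₀, hLST⟩ := lst_constantDepth_imm_lower_bound_holds.{0} ℂ 1 le_rfl
  obtain ⟨d, n, hd₀, -, hn1, hdlog, hlt⟩ := chasm_arith (a * c + c + 1) hδ hε d₀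
  obtain ⟨m, hm, hproj⟩ := ha n d
  obtain ⟨P, hPc, hPpd, hPE⟩ := (hc m).2.2
  obtain ⟨Q, hQc, hQpd, -, hQs⟩ := exists_sps_of_isProjection hproj hPc
  have hlow := hLST n d hd₀ hdlog Q (hQpd.trans hPpd) hQc
  -- the arithmetic
  have hX2 : 2 ≤ n + 2 * n ^ 3 * d + 2 := by omega
  have hndX : n + d + 2 ≤ n + 2 * n ^ 3 * d + 2 := by
    have h3 : 1 ≤ n ^ 3 := Nat.one_le_pow _ _ hn1
    have : d ≤ 2 * n ^ 3 * d := by nlinarith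
    omega
  have hmX : m ≤ (n + 2 * n ^ 3 * d + 2) ^ a := hm.trans (Nat.pow_le_pow_left hndX a)
  have h1 : Q.size ≤ (n + 2 * n ^ 3 * d + 2) ^ (a * c + c + 1) :=
    hQs.trans (hPE.trans (pow_add_le_pow hmX hX2))
  have h2 : (n + 2 * n ^ 3 * d + 2) ^ (a * c + c + 1) ≤
      ((n + 2 * n ^ 3 * d + 2) ^ (a * c + c + 1) * 2 ^ ((a * c + c + 1) * Nat.sqrt d + (a * c + c + 1)) + 2) ^ 2 :=
    calc (n + 2 * n ^ 3 * d + 2) ^ (a * c + c + 1)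
        ≤ (n + 2 * n ^ 3 * d + 2) ^ (a * c + c + 1) * 2 ^ ((a * c + c + 1) * Nat.sqrt d + (a * c + c + 1)) :=
          Nat.le_mul_of_pos_right _ (Nat.two_pow_pos _)
      _ ≤ (n + 2 * n ^ 3 * d + 2) ^ (a * c + c + 1) * 2 ^ ((a * c + c + 1) * Nat.sqrt d + (a * c + c + 1)) + 2 :=
          Nat.le_add_right _ _
      _ ≤ _ := Nat.le_self_pow (by norm_num) _
  have h3 : (Q.size : ℝ) ≤ ((((n + 2 * n ^ 3 * d + 2) ^ (a * c + c + 1) *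
      2 ^ ((a * c + c + 1) * Nat.sqrt d + (a * c + c + 1)) + 2) ^ 2 : ℕ) : ℝ) := by
    exact_mod_cast h1.trans h2
  exact absurd (hlow.trans h3) (not_le.2 hlt)

/-! ### The permanent is `IMM`-hard with polynomial blow-up (Valiant completeness, in the tree) -/

/-- **`IMM_{n,d}` is a projection of `per_m`, `m ≤ (n + d + 2)^a`.**  The universal `IMM` family
`N ↦ IMM_{(unpair N).1, (unpair N).2}` (renamed to `Fin`-indexed variables) is a `VP` family — `≤ N³` variables,
degree `≤ N`, complexity `≤ N + 2N⁴` by `complexity_immPoly_le` — hence a `VNP` family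
(`IsVPFamily.isVNPFamily_holds'`), hence a p-projection of the permanent (`isVNPComplete_perPoly_holds`, `char ℂ = 0`);
read it at `N = pair n d ≤ (n + d + 2)²`. [cite: Burgisser2000, Thm 2.10 and Def. 2.6; Valiant1979] -/
theorem perPoly_immProjection :
    ∃ a : ℕ, ∀ n d : ℕ, ∃ m : ℕ, m ≤ (n + d + 2) ^ a ∧ IsProjection (immPoly n d ℂ) (perPoly (Fin m) ℂ) := by
  have h2 : ringChar ℂ ≠ 2 := by rw [ringChar.eq_zero]; norm_num
  have hper := isVNPComplete_perPoly_holds ℂ h2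
  let g : (N : ℕ) → MvPolynomial
      (Fin (Fintype.card (Fin (Nat.unpair N).2 × Fin (Nat.unpair N).1 × Fin (Nat.unpair N).1))) ℂ :=
    fun N => rename (Fintype.equivFin (Fin (Nat.unpair N).2 × Fin (Nat.unpair N).1 × Fin (Nat.unpair N).1))
      (immPoly (Nat.unpair N).1 (Nat.unpair N).2 ℂ)
  have hgVP : IsVPFamily g := by
    refine ⟨⟨⟨3, fun N => ?_⟩, ⟨1, fun N => ?_⟩⟩, ⟨5, fun N => ?_⟩⟩
    · -- number of variables
      have h1 := Nat.unpair_left_le N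
      have h2 := Nat.unpair_right_le N
      simp only [Fintype.card_fin, Fintype.card_prod]
      calc (Nat.unpair N).2 * ((Nat.unpair N).1 * (Nat.unpair N).1) ≤ N * (N * N) :=
            Nat.mul_le_mul h2 (Nat.mul_le_mul h1 h1)
        _ = N ^ 3 := by ring
        _ ≤ N ^ 3 + 3 := Nat.le_add_right _ _
    · -- degree
      calc (g N).totalDegree ≤ (immPoly (Nat.unpair N).1 (Nat.unpair N).2 ℂ).totalDegree :=
            totalDegree_rename_le _ _
        _ ≤ (Nat.unpair N).2 := (immPoly_isHomogeneous_holds (k := ℂ) _ _).totalDegree_le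
        _ ≤ N := Nat.unpair_right_le N
        _ ≤ N ^ 1 + 1 := by rw [pow_one]; omega
    · -- complexity
      have h1 := Nat.unpair_left_le N
      have h2 := Nat.unpair_right_le N
      calc complexity (g N) ≤ complexity (immPoly (Nat.unpair N).1 (Nat.unpair N).2 ℂ) :=
            complexity_rename_le_holds' _ _
        _ ≤ (Nat.unpair N).1 + 2 * (Nat.unpair N).1 ^ 3 * (Nat.unpair N).2 := complexity_immPoly_le ℂ _ _
        _ ≤ N + 2 * N ^ 3 * N :=
            Nat.add_le_add h1 (Nat.mul_le_mul (Nat.mul_le_mul_left 2 (Nat.pow_le_pow_left h1 3)) h2)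
        _ ≤ N ^ 5 + 5 := by
            rcases Nat.lt_or_ge N 3 with hN | hN
            · interval_cases N <;> norm_num
            · have hN4 : N ≤ N ^ 4 := Nat.le_self_pow (by norm_num) N
              have hN5 : 3 * N ^ 4 ≤ N ^ 5 := by
                calc 3 * N ^ 4 ≤ N * N ^ 4 := Nat.mul_le_mul_right _ hN
                  _ = N ^ 5 := by ring
              nlinarith
  have hg : IsVNPFamily g := IsVPFamily.isVNPFamily_holds' hgVP
  obtain ⟨t, ⟨a, hta⟩, hproj⟩ := hper.2 _ g hg
  refine ⟨2 * a + 1, fun n d => ⟨t (Nat.pair n d), ?_, ?_⟩⟩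
  · -- the blow-up
    have hY2 : 2 ≤ n + d + 2 := by omega
    have hpair : Nat.pair n d ≤ (n + d + 2) ^ 2 :=
      (Nat.pair_lt_max_add_one_sq n d).le.trans (Nat.pow_le_pow_left (by omega) 2)
    calc t (Nat.pair n d) ≤ (Nat.pair n d) ^ a + a := hta _
      _ ≤ ((n + d + 2) ^ 2) ^ a + (n + d + 2) ^ a :=
          Nat.add_le_add (Nat.pow_le_pow_left hpair a)
            (Nat.lt_two_pow_self.le.trans (Nat.pow_le_pow_left hY2 a))
      _ ≤ (n + d + 2) ^ (2 * a) + (n + d + 2) ^ (2 * a) := by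
          rw [← pow_mul]
          exact Nat.add_le_add le_rfl (Nat.pow_le_pow_right (by omega) (by omega))
      _ = 2 * (n + d + 2) ^ (2 * a) := by ring
      _ ≤ (n + d + 2) * (n + d + 2) ^ (2 * a) := Nat.mul_le_mul_right _ hY2
      _ = (n + d + 2) ^ (2 * a + 1) := by ring
  · -- the projection, read at `N = pair n d`
    have h := isProjection_rename (hproj (Nat.pair n d))
      (Fintype.equivFin (Fin (Nat.unpair (Nat.pair n d)).2 × Fin (Nat.unpair (Nat.pair n d)).1 ×
        Fin (Nat.unpair (Nat.pair n d)).1)).symm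
    have hgg : rename (Fintype.equivFin (Fin (Nat.unpair (Nat.pair n d)).2 × Fin (Nat.unpair (Nat.pair n d)).1 ×
        Fin (Nat.unpair (Nat.pair n d)).1)).symm (g (Nat.pair n d)) =
        immPoly (Nat.unpair (Nat.pair n d)).1 (Nat.unpair (Nat.pair n d)).2 ℂ := by
      simp only [g]
      rw [rename_rename, Equiv.symm_comp_self, rename_id_apply]
    rw [hgg] at h
    rw [Nat.unpair_pair] at h
    exact h

/-! ### The permanent is outside the rung's hypothesis class — unconditionally -/

/-- **THE PERMANENT HAS NO POLYNOMIAL-SIZE `ΣΠΣ` CIRCUITS OVER `ℂ` (in the `PDClass 1` envelope), UNCONDITIONALLY.**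
The conclusion of `RungCalibration.perPoly_not_pdClassOne_of_sigmaPiSigmaValue` without its hypothesis `A_∞`:
Limaye–Srinivasan–Tavenas Cor. 4 (proved in the tree) transported along Valiant's p-projection of the universal
`IMM` family onto the permanent (proved in the tree).  So the per-instance of the rung's "lower-bound content" is a
theorem of the tree and carries no evidence about `A_∞` either way. [cite: LimayeSrinivasanTavenas2021, Cor. 4; Valiant1979] -/
theorem perPoly_not_pdClassOne :
    ¬ ∃ c : ℕ, ∀ n : ℕ, PDClass (fun _ => 1) n c (perPoly (Fin n) ℂ) :=
  not_pdClassOne_of_immProjection _ perPoly_immProjection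

/-- **No `IMM`-hard kill witness.**  The refutation instrument of the rung
(`RungCalibration.sigmaPiSigmaValue_false_of_separating`) asks for a family in `PDClass 1 · c` (some `c`) whose
values separate graphs of polylogarithmic counting width.  Whatever else it is, such a family is NOT `IMM`-hard:
`IMM_{n,d}` is not a projection of it with polynomial blow-up — so it is not `VNP`-, `VP`- or `VBP`-complete and
none of those classes' complete families reduces to it.  (Contrapositive of `not_pdClassOne_of_immProjection`.)
[cite: LimayeSrinivasanTavenas2021, Cor. 4; DawarWilsenach2025, §8] -/
theorem killWitness_not_immHard {f : (n : ℕ) → MvPolynomial (Fin n × Fin n) ℂ}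
    (hPD : ∃ c : ℕ, ∀ n : ℕ, PDClass (fun _ => 1) n c (f n)) :
    ¬ ∃ a : ℕ, ∀ n d : ℕ, ∃ m : ℕ, m ≤ (n + d + 2) ^ a ∧ IsProjection (immPoly n d ℂ) (f m) :=
  fun hF => not_pdClassOne_of_immProjection f hF hPD

/-! ### Where a counterexample to `A_∞` can live (appended) -/

/-- **THE COUNTEREXAMPLE WINDOW FOR `A_∞`.**  Let `f` be matrix-symmetric and in the rung's hypothesis class
(`PDClass (fun _ => 1) n c (f n)` for one `c` and all `n`) but NOT quasi-polynomially orbit-restorable (`f` would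
refute `stub_sigmaPiSigmaValue`).  Then
(i) the degree of `f` exceeds every polylogarithm somewhere: for every `c` some level has
`(log₂ n + c)^c < deg (f n)` — the polylog-degree floor (orbit circuit of a quasi-polynomially sparse polynomial);
(ii) `f` is not `IMM`-hard: `IMM_{n,d}` is not a projection of `f m` with polynomial blow-up `m ≤ (n + d + 2)^a`
(Limaye–Srinivasan–Tavenas at product-depth one, `killWitness_not_immHard`) — so `f` is complete for none of
`VBP ⊆ VP ⊆ VNP`;
(iii) for every `c` there is a level `n` at which `f n` is not `c`-restorable, some double-difference derivation
`∂_{ab} − ∂_{a'b} − ∂_{ab'} + ∂_{a'b'}` does not kill `f n` (`f n ∉ ℂ[r, c]`, the row/column stratum, constant `9`), and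
`f n` is not invariant under the permutations inside some row (the wreath stratum, constant `12`).
[cite: LimayeSrinivasanTavenas2021, Cor. 4; DawarWilsenach2025, §3.3 and §8] -/
theorem counterexample_window {f : (n : ℕ) → MvPolynomial (Fin n × Fin n) ℂ}
    (hsym : IsMatrixSymmetric f) (hPD : ∃ c : ℕ, ∀ n : ℕ, PDClass (fun _ => 1) n c (f n))
    (hno : ¬ ∃ c : ℕ, ∀ n : ℕ, QPOrbitRestorable c n (f n)) :
    (∀ c : ℕ, ∃ n : ℕ, (Nat.log 2 n + c) ^ c < (f n).totalDegree) ∧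
    (¬ ∃ a : ℕ, ∀ n d : ℕ, ∃ m : ℕ, m ≤ (n + d + 2) ^ a ∧ IsProjection (immPoly n d ℂ) (f m)) ∧
    (∀ c : ℕ, ∃ n : ℕ, ¬ QPOrbitRestorable c n (f n) ∧
      (∃ a a' b b' : Fin n, pderiv (a, b) (f n) - pderiv (a', b) (f n) - pderiv (a, b') (f n) +
        pderiv (a', b') (f n) ≠ 0) ∧
      ∃ (i : Fin n) (τ : Equiv.Perm (Fin n)),
        rename (fun q : Fin n × Fin n => if q.1 = i then (q.1, τ q.2) else q) (f n) ≠ f n) := by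
  refine ⟨fun c => ?_, killWitness_not_immHard hPD, fun c => ?_⟩
  · by_contra h
    push Not at h
    apply hno
    obtain ⟨c', hc'⟩ := OrbitToNarrowExpression.qpOrbit_of_polylogDegree_of_diagInvariant f
      (fun n σ => hsym n σ σ) ⟨c, h⟩
    exact ⟨c', fun n => hc' n⟩
  · by_contra h
    push Not at h
    apply hno
    refine ⟨max c 12, fun n => ?_⟩
    by_cases h1 : QPOrbitRestorable c n (f n)
    · exact Restorable.qpOrbitRestorable_mono (le_max_left _ _) h1
    by_cases hD : ∀ a a' b b' : Fin n, pderiv (a, b) (f n) - pderiv (a', b) (f n) - pderiv (a, b') (f n) +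
        pderiv (a', b') (f n) = 0
    · exact Restorable.qpOrbitRestorable_mono (le_max_of_le_right (by norm_num))
        (RowColumnDerivativeConverse.qpOrbitRestorable_of_forall_ddiffDeriv_eq_zero (hsym n) hD)
    push Not at hD
    exact Restorable.qpOrbitRestorable_mono (le_max_right _ _)
      (RowColumnWreath.qpOrbitRestorable_of_rowwise_symmetric (hsym n) (h n h1 hD))

/-! ### No `VNP`-hard family is in the rung's hypothesis class (appended) -/

/-- **TRANSFER ALONG THE PERMANENT.**  If the permanents are projections of the family `F` with polynomial blow-up
(`per_m` a projection of `F m'` for some `m' ≤ (m + 2)^b`) — e.g. `F` is `VNP`-hard under p-projections with an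
explicit polynomial bound — then `F` lies in the `ΣΠΣ` slice `PDClass (fun _ => 1) · c` for NO `c`: compose with
`perPoly_immProjection` (`IsProjection.trans_holds`) and apply `not_pdClassOne_of_immProjection`.  In particular the
kill instrument of `A_∞` can never be fed a `VNP`-hard family. [cite: LimayeSrinivasanTavenas2021, Cor. 4; Burgisser2000, §2.1] -/
theorem not_pdClassOne_of_perProjection (F : (m : ℕ) → MvPolynomial (Fin m × Fin m) ℂ)
    (hF : ∃ b : ℕ, ∀ m : ℕ, ∃ m' : ℕ, m' ≤ (m + 2) ^ b ∧ IsProjection (perPoly (Fin m) ℂ) (F m')) :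
    ¬ ∃ c : ℕ, ∀ m : ℕ, PDClass (fun _ => 1) m c (F m) := by
  apply not_pdClassOne_of_immProjection
  obtain ⟨a, ha⟩ := perPoly_immProjection
  obtain ⟨b, hb⟩ := hF
  refine ⟨(a + 2) * b, fun n d => ?_⟩
  obtain ⟨m, hm, hproj⟩ := ha n d
  obtain ⟨m', hm', hproj'⟩ := hb m
  refine ⟨m', ?_, IsProjection.trans_holds hproj hproj'⟩
  have h1 : 1 ≤ (n + d + 2) ^ a := Nat.one_le_pow _ _ (by omega)
  have h4 : 4 ≤ (n + d + 2) ^ 2 :=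
    calc 4 = 2 ^ 2 := by norm_num
      _ ≤ (n + d + 2) ^ 2 := Nat.pow_le_pow_left (by omega) 2
  have hstep : (n + d + 2) ^ a + 2 ≤ (n + d + 2) ^ (a + 2) :=
    calc (n + d + 2) ^ a + 2 ≤ (n + d + 2) ^ 2 * (n + d + 2) ^ a := by nlinarith
      _ = (n + d + 2) ^ (a + 2) := by ring
  calc m' ≤ (m + 2) ^ b := hm'
    _ ≤ ((n + d + 2) ^ a + 2) ^ b := Nat.pow_le_pow_left (by omega) b
    _ ≤ ((n + d + 2) ^ (a + 2)) ^ b := Nat.pow_le_pow_left hstep b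
    _ = (n + d + 2) ^ ((a + 2) * b) := by rw [← pow_mul]

/-! ### No `VNP`-complete family has polynomial `ΣΠΣ` circuits over `ℂ` (appended) -/

/-- **NO `VNP`-COMPLETE FAMILY IS IN THE RUNG'S HYPOTHESIS CLASS** (the tree's `IsVNPComplete`, by name).  If a family
`f` on the `n × n` variable matrices lies in `PDClass (fun _ => 1) · c` for some `c`, then `f` is not `VNP`-complete:
otherwise the (renamed, `Fin`-indexed) permanent family — a `VNP` family by `isVNPFamily_perPoly_holds` and
`mem_VNP_ofFintype_iff_holds` — would be a p-projection of `f`, and `not_pdClassOne_of_perProjection` applies.  This is the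
kernel form of the line's remark "by LST21 no `VNP`-complete family has polynomial `ΣΠΣ` circuits over `ℂ`" (skeleton
`Lines/depth_three_rung.lean`, module docstring), previously only probed. [cite: LimayeSrinivasanTavenas2021, Cor. 4; Valiant1979] -/
theorem not_isVNPComplete_of_pdClassOne {f : (n : ℕ) → MvPolynomial (Fin n × Fin n) ℂ}
    (hPD : ∃ c : ℕ, ∀ n : ℕ, PDClass (fun _ => 1) n c (f n)) : ¬ IsVNPComplete f := by
  intro hf
  refine not_pdClassOne_of_perProjection f ?_ hPD
  have hmem : PolyFamily.ofFintype (fun n => perPoly (Fin n) ℂ) ∈ VNP ℂ :=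
    (mem_VNP_ofFintype_iff_holds (fun n => perPoly (Fin n) ℂ)).mpr (isVNPFamily_perPoly_holds ℂ)
  obtain ⟨t, ⟨a, hta⟩, hproj⟩ := hf.2 _ (PolyFamily.ofFintype (fun n => perPoly (Fin n) ℂ)).poly hmem
  refine ⟨a + 1, fun m => ⟨t m, ?_, ?_⟩⟩
  · have hY : 2 ≤ m + 2 := by omega
    calc t m ≤ m ^ a + a := hta m
      _ ≤ (m + 2) ^ a + (m + 2) ^ a :=
          Nat.add_le_add (Nat.pow_le_pow_left (by omega) a) (Nat.lt_two_pow_self.le.trans (Nat.pow_le_pow_left hY a))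
      _ = 2 * (m + 2) ^ a := by ring
      _ ≤ (m + 2) * (m + 2) ^ a := Nat.mul_le_mul_right _ hY
      _ = (m + 2) ^ (a + 1) := by ring
  · have h := isProjection_rename (hproj m) (Fintype.equivFin (Fin m × Fin m)).symm
    have hgg : rename (Fintype.equivFin (Fin m × Fin m)).symm
        ((PolyFamily.ofFintype (fun n => perPoly (Fin n) ℂ)).poly m) = perPoly (Fin m) ℂ := by
      change rename (Fintype.equivFin (Fin m × Fin m)).symm
        (renameEquiv ℂ (Fintype.equivFin (Fin m × Fin m)) (perPoly (Fin m) ℂ)) = perPoly (Fin m) ℂ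
      rw [renameEquiv_apply, rename_rename, Equiv.symm_comp_self, rename_id_apply]
    obtain ⟨α, hα, hEq⟩ := h
    exact ⟨α, hα, hgg.symm.trans hEq⟩

/-- The counterexample window, by-name form of (ii): a refutation witness for `stub_sigmaPiSigmaValue` is not
`VNP`-complete. [cite: LimayeSrinivasanTavenas2021, Cor. 4] -/
theorem counterexample_not_isVNPComplete {f : (n : ℕ) → MvPolynomial (Fin n × Fin n) ℂ}
    (_hsym : IsMatrixSymmetric f) (hPD : ∃ c : ℕ, ∀ n : ℕ, PDClass (fun _ => 1) n c (f n))
    (_hno : ¬ ∃ c : ℕ, ∀ n : ℕ, QPOrbitRestorable c n (f n)) : ¬ IsVNPComplete f :=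
  not_isVNPComplete_of_pdClassOne hPD

end PermanentOutsideRung

end Summit.ValiantsHypothesis.ValiantsHypothesis.Theorems.OrbitRestorationQPDepthThreeRung

end
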